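import Mathlib
import Summits.Ventures.DiscreteObjects.Mahler.CensusEsymmBound
import Summits.Ventures.DiscreteObjects.Mahler.SmallMeasureCensus

/-!
# Trace polynomials, the Chebyshev–Graeffe step and the coefficient bound (venture `DiscreteObjects`, target L)

Cell `pub-namedobj`, seat `pub-namedobj-mahler-g16`. Framing: lottery ticket; floor = certified bounds/negative ranges.

Root-level facts behind the cheaper rejection certificate `tgr` of the degree-20 kernel census (`CensusTraceCertificate`).
For a reciprocal `P = ∏_i (X² - y_i X + 1)` (i.e. `P(x) = x^d Q(x + 1/x)`, `Q = ∏ (X - y_i)` the TRACE polynomial):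
* `jouk y := M(X² - yX + 1) = max(|β|, |β|⁻¹)` for `y = β + β⁻¹`; `1 ≤ jouk y`, `|y| ≤ jouk y + (jouk y)⁻¹`,
  `jouk (y² - 2) = (jouk y)²` (root squaring `β ↦ β²` is `y ↦ y² - 2` on traces);
* `mahlerMeasure_prod_quadOf`: `M(P) = ∏ jouk y_i`; `eq_prod_quadOf_of_eval`: the product form from the evaluation
  identity `P(β) = β^d Q(β + β⁻¹)` (`β ≠ 0`);
* `chebGraeffe_roots`: if `G(X²) = (-1)^d Q(X) Q(-X)` then `G(X + 2) = ∏ (X - (y_i² - 2))` (CHEBYSHEV–GRAEFFE step);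
* `norm_coeff_trace_le`: if `∏ jouk y_i ≤ B'` then `|coeff_{d-k-1}(Q)| ≤ 2^{k+1} C(d-1,k+1) + (B' + B'⁻¹) 2^k C(d-1,k)`
  (the merging bound of `CensusEsymmBound`) — violated by a Chebyshev–Graeffe iterate means `M(P)^{2^m} > B'`.
-/

namespace Summit.Ventures.DiscreteObjects.Mahler

open Polynomial

/-! ## The quadratic `X² - yX + 1` and `jouk` -/

/-- The reciprocal quadratic with trace `y`. -/
noncomputable def quadOf (y : ℂ) : ℂ[X] := X ^ 2 - C y * X + 1

/-- `jouk y = M(X² - yX + 1)`: the larger modulus of the two roots `β, β⁻¹` (or `1`). -/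
noncomputable def jouk (y : ℂ) : ℝ := (quadOf y).mahlerMeasure

/-- `X² - (β + β⁻¹)X + 1 = (X - β)(X - β⁻¹)`. -/
theorem quadOf_eq_mul {β : ℂ} (hβ : β ≠ 0) : quadOf (β + β⁻¹) = (X - C β) * (X - C β⁻¹) := by
  unfold quadOf
  have h2 : C β * C β⁻¹ = (1 : ℂ[X]) := by rw [← map_mul, mul_inv_cancel₀ hβ, map_one]
  rw [map_add, show (X - C β) * (X - C β⁻¹) = X ^ 2 - (C β + C β⁻¹) * X + C β * C β⁻¹ by ring, h2]

/-- Every `y` is `β + β⁻¹` for some `β ≠ 0`. -/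
theorem exists_eq_add_inv (y : ℂ) : ∃ β : ℂ, β ≠ 0 ∧ y = β + β⁻¹ := by
  have hdeg : (quadOf y).degree = 2 := by
    unfold quadOf; compute_degree!
  obtain ⟨z, hz⟩ := Complex.exists_root (f := quadOf y) (by rw [hdeg]; norm_num)
  have hz' : z ^ 2 - y * z + 1 = 0 := by
    have := hz
    unfold quadOf at this
    simpa [IsRoot] using this
  have hz0 : z ≠ 0 := by
    rintro rfl
    norm_num at hz'
  refine ⟨z, hz0, ?_⟩
  have h2 : y * z = z ^ 2 + 1 := by linear_combination -hz'
  calc y = y * z * z⁻¹ := by rw [mul_assoc, mul_inv_cancel₀ hz0, mul_one]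
    _ = (z ^ 2 + 1) * z⁻¹ := by rw [h2]
    _ = z + z⁻¹ := by rw [add_mul, pow_two, mul_assoc, mul_inv_cancel₀ hz0, mul_one, one_mul]

/-- `M((X - β)(X - β⁻¹)) = max |β| |β|⁻¹`. -/
theorem mahlerMeasure_X_sub_C_mul_inv {β : ℂ} (hβ : β ≠ 0) :
    ((X - C β) * (X - C β⁻¹) : ℂ[X]).mahlerMeasure = max ‖β‖ ‖β‖⁻¹ := by
  rw [mahlerMeasure_mul, mahlerMeasure_X_sub_C, mahlerMeasure_X_sub_C, norm_inv]
  have hr : 0 < ‖β‖ := norm_pos_iff.mpr hβ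
  rcases le_or_gt 1 ‖β‖ with h | h
  · have h' : ‖β‖⁻¹ ≤ 1 := inv_le_one_of_one_le₀ h
    rw [max_eq_right h, max_eq_left h', mul_one, max_eq_left (h'.trans h)]
  · have h' : 1 ≤ ‖β‖⁻¹ := (one_le_inv₀ hr).mpr h.le
    rw [max_eq_left h.le, max_eq_right h', one_mul, max_eq_right (h.le.trans h')]

/-- `jouk (β + β⁻¹) = max |β| |β|⁻¹`. -/
theorem jouk_add_inv {β : ℂ} (hβ : β ≠ 0) : jouk (β + β⁻¹) = max ‖β‖ ‖β‖⁻¹ := by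
  rw [jouk, quadOf_eq_mul hβ, mahlerMeasure_X_sub_C_mul_inv hβ]

/-- `1 ≤ jouk y`. -/
theorem one_le_jouk (y : ℂ) : 1 ≤ jouk y := by
  obtain ⟨β, hβ, rfl⟩ := exists_eq_add_inv y
  rw [jouk_add_inv hβ]
  have hr : 0 < ‖β‖ := norm_pos_iff.mpr hβ
  rcases le_or_gt 1 ‖β‖ with h | h
  · exact h.trans (le_max_left _ _)
  · exact ((one_le_inv₀ hr).mpr h.le).trans (le_max_right _ _)

/-- `|y| ≤ jouk y + (jouk y)⁻¹`. -/
theorem norm_le_joukRad_jouk (y : ℂ) : ‖y‖ ≤ joukRad (jouk y) := by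
  obtain ⟨β, hβ, rfl⟩ := exists_eq_add_inv y
  rw [jouk_add_inv hβ, joukRad]
  have hr : 0 < ‖β‖ := norm_pos_iff.mpr hβ
  have hle : ‖β + β⁻¹‖ ≤ ‖β‖ + ‖β‖⁻¹ := by rw [← norm_inv]; exact norm_add_le _ _
  rcases le_or_gt 1 ‖β‖ with h | h
  · rwa [max_eq_left ((inv_le_one_of_one_le₀ h).trans h)]
  · rw [max_eq_right (h.le.trans ((one_le_inv₀ hr).mpr h.le)), inv_inv]; linarith

/-- Root squaring on traces: `jouk (y² - 2) = (jouk y)²`. -/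
theorem jouk_sq_sub_two (y : ℂ) : jouk (y ^ 2 - 2) = jouk y ^ 2 := by
  obtain ⟨β, hβ, rfl⟩ := exists_eq_add_inv y
  have hβ2 : β ^ 2 ≠ 0 := pow_ne_zero 2 hβ
  have e : (β + β⁻¹) ^ 2 - 2 = β ^ 2 + (β ^ 2)⁻¹ := by field_simp; ring
  rw [e, jouk_add_inv hβ2, jouk_add_inv hβ, norm_pow, ← inv_pow]
  have hr : 0 < ‖β‖ := norm_pos_iff.mpr hβ
  rcases le_or_gt 1 ‖β‖ with h | h
  · have h' : ‖β‖⁻¹ ≤ 1 := inv_le_one_of_one_le₀ h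
    rw [max_eq_left (h'.trans h), max_eq_left]
    exact pow_le_pow_left₀ (by positivity) (h'.trans h) 2
  · have h' : 1 ≤ ‖β‖⁻¹ := (one_le_inv₀ hr).mpr h.le
    rw [max_eq_right (h.le.trans h'), max_eq_right]
    exact pow_le_pow_left₀ hr.le (h.le.trans h') 2

/-! ## Products of reciprocal quadratics -/

/-- `M(∏ (X² - y_i X + 1)) = ∏ jouk y_i`. -/
theorem mahlerMeasure_prod_quadOf (ys : Multiset ℂ) : (ys.map quadOf).prod.mahlerMeasure = (ys.map jouk).prod := by
  rw [prod_mahlerMeasure_eq_mahlerMeasure_prod, Multiset.map_map]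
  rfl

/-- `(∏ quadOf y_i)(β) = β^{#ys} · (∏ (X - y_i))(β + β⁻¹)` for `β ≠ 0`. -/
theorem eval_prod_quadOf {β : ℂ} (hβ : β ≠ 0) (ys : Multiset ℂ) :
    (ys.map quadOf).prod.eval β = β ^ Multiset.card ys * (ys.map fun y => X - C y).prod.eval (β + β⁻¹) := by
  induction ys using Multiset.induction_on with
  | empty => simp
  | cons y ys ih =>
    rw [Multiset.map_cons, Multiset.prod_cons, eval_mul, ih, Multiset.map_cons, Multiset.prod_cons, eval_mul,
      Multiset.card_cons, pow_succ]
    have e : (quadOf y).eval β = β * (X - C y : ℂ[X]).eval (β + β⁻¹) := by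
      simp only [quadOf, eval_add, eval_sub, eval_pow, eval_X, eval_mul, eval_C, eval_one]
      field_simp
      ring
    rw [e]; ring

/-- **Product form from the evaluation identity.** If `Q = ∏ (X - y_i)` with `#ys = d` and
`P(β) = β^d Q(β + β⁻¹)` for all `β ≠ 0`, then `P = ∏ (X² - y_i X + 1)`. -/
theorem eq_prod_quadOf_of_eval {P Q : ℂ[X]} {ys : Multiset ℂ} {d : ℕ} (hQ : Q = (ys.map fun y => X - C y).prod)
    (hcard : Multiset.card ys = d) (hev : ∀ β : ℂ, β ≠ 0 → P.eval β = β ^ d * Q.eval (β + β⁻¹)) :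
    P = (ys.map quadOf).prod := by
  apply Polynomial.eq_of_infinite_eval_eq P _
  apply ((Set.finite_singleton (0 : ℂ)).infinite_compl).mono
  intro β hβ
  have hβ' : β ≠ 0 := hβ
  show P.eval β = ((ys.map quadOf).prod).eval β
  rw [hev β hβ', eval_prod_quadOf hβ', hcard, hQ]

/-! ## The Chebyshev–Graeffe step on roots -/

/-- `(-1)^{#ys} · Q(X) Q(-X) = ∏ (X² - y_i²)` for `Q = ∏ (X - y_i)`. -/
theorem neg_one_pow_mul_prod_mul_comp_neg (ys : Multiset ℂ) :
    (-1 : ℂ[X]) ^ Multiset.card ys * ((ys.map fun y => X - C y).prod * ((ys.map fun y => X - C y).prod).comp (-X)) =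
      ((ys.map fun y => X - C (y ^ 2)).prod).comp (X ^ 2) := by
  induction ys using Multiset.induction_on with
  | empty => simp
  | cons y ys ih =>
    rw [Multiset.map_cons, Multiset.map_cons, Multiset.prod_cons, Multiset.prod_cons, Multiset.card_cons, pow_succ,
      mul_comp, mul_comp, ← ih, sub_comp, sub_comp, X_comp, X_comp, C_comp, C_comp, map_pow]
    ring

/-- Polynomials over `ℂ` agreeing after the substitution `X ↦ X²` are equal. -/
theorem eq_of_comp_X_sq_eq {G H : ℂ[X]} (h : G.comp (X ^ 2) = H.comp (X ^ 2)) : G = H := by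
  apply Polynomial.funext
  intro w
  obtain ⟨z, hz⟩ := IsAlgClosed.exists_pow_nat_eq w (n := 2) (by norm_num)
  have := congrArg (fun p : ℂ[X] => p.eval z) h
  simpa [eval_comp, hz] using this

/-- **Chebyshev–Graeffe step.** If `G(X²) = (-1)^d Q(X) Q(-X)` for `Q = ∏ (X - y_i)`, `#ys = d`, then
`G(X + 2) = ∏ (X - (y_i² - 2))`. -/
theorem chebGraeffe_roots {Q G : ℂ[X]} {ys : Multiset ℂ} (hQ : Q = (ys.map fun y => X - C y).prod)
    (hG : G.comp (X ^ 2) = (-1 : ℂ[X]) ^ Multiset.card ys * (Q * Q.comp (-X))) :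
    G.comp (X + C 2) = ((ys.map fun y => y ^ 2 - 2).map fun y => X - C y).prod := by
  rw [hQ, neg_one_pow_mul_prod_mul_comp_neg] at hG
  have hG' := eq_of_comp_X_sq_eq hG
  rw [hG', multiset_prod_comp, Multiset.map_map, Multiset.map_map]
  refine congrArg Multiset.prod (Multiset.map_congr rfl fun y _ => ?_)
  simp only [Function.comp_apply, sub_comp, X_comp, pow_comp, C_comp, map_sub, map_pow, map_ofNat]
  ring

/-- Root squaring squares the product of the `jouk`: `∏ jouk (y_i² - 2) = (∏ jouk y_i)²`. -/
theorem prod_jouk_sq_sub_two (ys : Multiset ℂ) :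
    ((ys.map fun y => y ^ 2 - 2).map jouk).prod = (ys.map jouk).prod ^ 2 := by
  rw [Multiset.map_map, ← Multiset.prod_map_pow]
  congr 1
  apply Multiset.map_congr rfl
  intro y _
  exact jouk_sq_sub_two y

/-! ## The coefficient bound -/

/-- **Coefficient bound for a trace polynomial.** If `Q = ∏_{i<d} (X - y_i)` and `∏ jouk y_i ≤ B'` then
`|coeff_{d-(k+1)}(Q)| ≤ 2^{k+1} C(d-1,k+1) + (B' + B'⁻¹) · 2^k C(d-1,k)` for `k + 1 ≤ d`. -/
theorem norm_coeff_trace_le {Q : ℂ[X]} {ys : Multiset ℂ} (hQ : Q = (ys.map fun y => X - C y).prod) {d : ℕ}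
    (hcard : Multiset.card ys = d) {B' : ℝ} (hprod : (ys.map jouk).prod ≤ B') {k : ℕ} (hk : k + 1 ≤ d) :
    ‖Q.coeff (d - (k + 1))‖ ≤
      2 ^ (k + 1) * ((d - 1).choose (k + 1) : ℝ) + joukRad B' * (2 ^ k * ((d - 1).choose k : ℝ)) := by
  have hle : d - (k + 1) ≤ Multiset.card ys := by rw [hcard]; omega
  rw [hQ, Multiset.prod_X_sub_C_coeff ys hle, hcard, show d - (d - (k + 1)) = k + 1 by omega, norm_mul, norm_pow,
    norm_neg, norm_one, one_pow, one_mul]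
  have h1 : ‖ys.esymm (k + 1)‖ ≤ (ys.map (joukRad ∘ jouk)).esymm (k + 1) :=
    norm_esymm_le_esymm_map (joukRad ∘ jouk) ys (fun y _ => norm_le_joukRad_jouk y) (k + 1)
  rw [← Multiset.map_map] at h1
  -- split off one element: `ys.map jouk = a ::ₘ R`
  have hpos : 0 < Multiset.card ys := by rw [hcard]; omega
  obtain ⟨y0, hy0⟩ := Multiset.card_pos_iff_exists_mem.mp hpos
  obtain ⟨ys', rfl⟩ := Multiset.exists_cons_of_mem hy0
  rw [Multiset.map_cons] at h1 hprod
  rw [Multiset.prod_cons] at hprod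
  have hR : ∀ r ∈ ys'.map jouk, 1 ≤ r := by
    intro r hr
    rw [Multiset.mem_map] at hr
    obtain ⟨y, _, rfl⟩ := hr
    exact one_le_jouk y
  have h2 := esymm_map_joukRad_le_closed hR (one_le_jouk y0) hprod k
  rw [Multiset.card_map] at h2
  rw [Multiset.card_cons] at hcard
  rw [show d - 1 = Multiset.card ys' by omega]
  exact h1.trans h2

end Summit.Ventures.DiscreteObjects.Mahler
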